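import Literature.Analysis.InnerProduct.IkedaIsospectralLensSpaces
import HarnessLib

/-!
# Ikeda's Proposition 1.7 (`Ψ_{q,3}` is determined by `|A_q(ω)|`) and his 5-DIMENSIONAL lens spaces which are isospectral but not
# homotopy equivalent: `L(13; 1, 2, 4) ~ L(13; 1, 4, 8)` and `L(13; 1, 2, 8) ~ L(13; 1, 4, 3)` (Ikeda 1980, Example (I)(ii))

Layer `Literature/Analysis/InnerProduct`, namespace `Literature.Analysis.InnerProduct`; lane `lit-hodgefound`, prover seat
`lit-hodgefound-p06`, generation 44, self-proposed row g44-#4. Continues row g44-#3 `IkedaIsospectralLensSpaces.lean` (imported: the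
complement trick, Propositions 2.5–2.6 `lensSpaceMultiplicity_eq_iff_ikedaPolynomial_eq`, Corollary 1.3 for `k = 2` and the
examples with `k = 2`) to Ikeda's case `k = 3`: the coefficient `a₃` of `Ψ_{q,3}(ω)` is `2q|A_q(ω)| − 20`, so `Ψ_{q,3}` — hence, by
Proposition 2.6, the spectrum of the complementary lens spaces `L(q : p₁, …, p_{q₀−3})` — depends on `ω` only through the number
`|A_q(ω)| ∈ {0, 1}` of sign patterns `(ξ, μ)` with `ω₁ + ξω₂ + μω₃ ≡ 0 (mod q)`. For `q = 13` (`q₀ = 6`, `n = k = 3`) this gives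
Ikeda's table of four 5-dimensional lens spaces falling into two isospectral pairs, each pair consisting of NON-homotopy-equivalent
manifolds (Theorem 2.2). THEOREMS ONLY (no definition, no instance, no notation, no named fact); `|A_q(ω)|` is written out as a sum
of four indicators.

## Source, verbatim (held text `paper:doi-10-24033-asens-1384`)

A. Ikeda, *On lens spaces which are isospectral but not isometric*, Ann. Sci. ÉNS (4) **13** (1980) 303–315. §1 (p0005–p0007):
"**Proposition 1.2.** If we put `Ψ_{q,k}((p₁, …, p_k)) = ∑_{i=0}^{2k}(−1)ⁱaᵢz^{2k−i}`, then we have: (i) `aᵢ = a_{2k−i}`; (ii) `a₀ =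
(q−1)`; (iii) `a₁ = −2k`; (iv) `a₂ = k(q − 2k + 1)`. … Let `p₁, p₂, p₃` be integers with `(p₁, p₂, p₃) ∈ Ĩ₀(q, 3)` … We define the
sets `A_q(p₁, p₂, p₃)` … by `A_q(p₁, p₂, p₃) = {(ξ, μ) : p₁ + ξp₂ + μp₃ ≡ 0 (mod q), ξ, μ ∈ {−1, 1}}` … **Lemma 1.4.** For any
element `(p₁, p₂, p₃) ∈ Ĩ₀(q, 3)`, we have `|A_q(p₁, p₂, p₃)| ≤ 1`. … We shall compute the coefficients `a₃`, `a₄` of the polynomial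
`Ψ_{q,4}((p₁, p₂, p₃, p₄))`: `a₃ = ∑_{l=1}^{q−1}{∑_{1≤i₁<i₂<i₃≤4}∑γ^{(±p_{i₁}±p_{i₂}±p_{i₃})l} + 6∑_{i=1}^{4}∑γ^{±pᵢl}} = 2q∑|A_q(p_{i₁},
p_{i₂}, p_{i₃})| − 2(16 − ∑|A_q(p_{i₁}, p_{i₂}, p_{i₃})|) − 24 …` **Proposition 1.7.** Let `(p₁, p₂, p₃), (s₁, s₂, s₃) ∈ I₀(q, 3)`. Then
we have `Ψ_{q,3}((p₁, p₂, p₃)) = Ψ_{q,3}((s₁, s₂, s₃))` if and only if `|A_q(p₁, p₂, p₃)| = |A_q(s₁, s₂, s₃)|`." §4 (p0012–p0013): "(I)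
5-dimensional examples (`n = 3`). … Case (ii): `q = 13`. Then `q₀ = 6`, `k = 3` and `r = 2`. `{1,1,4} ↦ L(13: 1, 2, 2²)`, `(q₁,q₂,q₃)
= (2³, 2⁴, 2⁵)`, `|A_q| = 0`; `{2,1,3} ↦ L(13: 1, 2², 2³)`, `(2, 2⁴, 2⁵)`, `0`; `{1,2,3} ↦ L(13: 1, 2, 2³)`, `(2², 2⁴, 2⁵)`, `1`;
`{2,2,2} ↦ L(13: 1, 2², 2⁴)`, `(2, 2³, 2⁵)`, `1`; where `(q₁, q₂, q₃) = ω((r^{a₁}, r^{a₂}, r^{a₃}))`. By Proposition 1.7 and 2.6, the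
lens spaces `L(13: 1, 2, 2²)` and `L(13: 1, 2², 2³)` are isospectral to each other, and also the lens spaces `L(13: 1, 2, 2³)`,
`L(13: 1, 2², 2⁴)` are isospectral. But these isospectral lens spaces are non-homotopy equivalent to each other. This fact follows
easily from the facts `rⁿ = 2³ ≡ 8 (mod 13)` and `(2³)² ≡ −1 (mod 13)`, and Theorem 2.2."

## The computation and what is proved (`q` prime; residues `2² = 4`, `2³ = 8`, `2⁴ ≡ 3`, `2⁵ ≡ 6 (mod 13)`)

`∏_{j<3}(z² − 2cⱼz + 1) = (z⁶+1) − e₁(z⁵+z) + (3+e₂)(z⁴+z²) − (2e₁+e₃)z³` with `e₁ = 2∑cⱼ`, `e₂ = 4∑_{i<j}cᵢcⱼ`, `e₃ = 8c₁c₂c₃`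
(`prod_fin_three_quadratic`); summing over `l = 1, …, q−1` with `cⱼ = cos(2πlωⱼ/q)`: `∑e₁ = −6`, `∑e₂ = −12` (rows g43/g44:
`∑_{l=1}^{q−1}cos(2πlw/q) = −1`, `∑cos·cos = −1`) and, by `cos x cos y cos z = ¼∑_±cos(x ± y ± z)`, `∑e₃ = 2q|A_q(ω)| − 8`
(`sum_Ico_cos_mul_cos_mul_cos`). Hence
* §1 **`IsIkedaWeights.ikedaPolynomial_fin_three`**: `Ψ_{q,3}(ω) = (q−1)(z⁶+1) + 6(z⁵+z) + (3q−15)(z⁴+z²) + (20 − 2q|A_q(ω)|)z³`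
  (Proposition 1.2 (i)–(iv) for `k = 3` together with `a₃ = 2q|A_q| − 20`), **`IsIkedaWeights.ikedaPolynomial_fin_three_eq`**
  (PROPOSITION 1.7, the direction `|A_q(ω)| = |A_q(ω')| ⇒ Ψ_{q,3}(ω) = Ψ_{q,3}(ω')`), `sum_Ico_cos_two_pi_mul_div_eq`.
* §2 the complements, checked as membership of the 6-tuples in `Ĩ₀(13, 6)` (`isIkedaWeights_thirteen_append_…`: `(1,2,4 | 3,5,6)`,
  `(1,4,8 | 2,3,6)`, `(1,2,8 | 3,4,6)`, `(1,4,3 | 2,5,6)` — Ikeda's `ω`'s up to sign), **`lensSpaceMultiplicity_thirteen_one_two_four_eq`**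
  (`L(13:1,2,4)` and `L(13:1,4,8)` ISOSPECTRAL, `|A| = 0`), **`lensSpaceMultiplicity_thirteen_one_two_eight_eq`** (`L(13:1,2,8)` and
  `L(13:1,4,3)` ISOSPECTRAL, `|A| = 1`), `lensSpaceMultiplicity_thirteen_one_two_four_ne` (the two pairs are not isospectral to each
  other: `dim E₂₁ = 4 ≠ 2`, `decide`), **`not_lensWeightsHomotopyEquivalent_thirteen_one_two_four`**,
  **`not_lensWeightsHomotopyEquivalent_thirteen_one_two_eight`** (NEITHER PAIR IS HOMOTOPY EQUIVALENT: Theorem 2.2's congruence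
  `s₁s₂s₃ ≡ ±l³p₁p₂p₃ (mod 13)` fails for every `l` and sign — the cubes mod 13 are `0, ±1, ±5` — by `interval_cases` + `decide`).
Not formalised: the converse direction of Proposition 1.7, Lemma 1.4 / 1.5, Proposition 1.6 (`k = 4`).

## References

* [Ikeda1980] A. Ikeda, *On lens spaces which are isospectral but not isometric*, Ann. Sci. ÉNS (4) 13 (1980) 303–315, Proposition 1.2,
  Lemma 1.4, Propositions 1.6–1.7, Theorem 2.2, Proposition 2.6, §4 Example (I) Case (ii).
* [IkedaYamamoto1979] A. Ikeda, Y. Yamamoto, *On the spectra of 3-dimensional lens spaces*, Osaka J. Math. 16 (1979) 447–469,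
  Corollary 2.3 (the dictionary multiplicity = `dim H_k^G`).
-/

noncomputable section

open Finset Polynomial.Chebyshev

namespace Literature.Analysis.InnerProduct

open _root_.Real

/-! ### §1 Proposition 1.7 (`k = 3`): `Ψ_{q,3}(ω)` depends on `ω ∈ Ĩ₀(q,3)` only through `|A_q(ω)|`, and the 5-dimensional
### examples (I)(ii): `L(13; 1,2,4) ~ L(13; 1,4,8)`, `L(13; 1,2,8) ~ L(13; 1,4,3)` isospectral and not homotopy equivalent -/

section PropOneSeven
open Polynomial

variable {q : ℕ} [hq : Fact q.Prime]

/-- `∑_{l=1}^{q−1} cos(2πlM/q) = q·[q ∣ M] − 1`. [cite: Ikeda1980, proof of Proposition 1.2 and of Proposition 1.6 (the sums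
`∑_{l=1}^{q−1}γ^{(p₁±p₂±p₃)l}`)] -/
theorem sum_Ico_cos_two_pi_mul_div_eq (M : ℤ) :
    ∑ l ∈ Finset.Ico 1 q, Real.cos (2 * π * l * M / q) = (if (q : ℤ) ∣ M then (q : ℝ) else 0) - 1 := by
  have hq0 : 0 < q := hq.out.pos
  have h := sum_range_cos_two_pi_mul_div q hq0.ne' M
  rw [Finset.sum_range_eq_add_Ico _ hq0] at h
  simp only [Nat.cast_zero, mul_zero, zero_mul, zero_div, Real.cos_zero] at h
  linarith

/-- `∑_{l=1}^{q−1} cos(2πla/q)cos(2πlb/q)cos(2πlc/q) = ¼∑_{ξ,μ=±1}(q·[q ∣ a + ξb + μc] − 1)`. [cite: Ikeda1980, proof of Proposition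
1.6 (`∑_l∑γ^{(±pᵢ₁±pᵢ₂±pᵢ₃)l} = 2q|A_q| − …`)] -/
theorem sum_Ico_cos_mul_cos_mul_cos (a b c : ℤ) :
    ∑ l ∈ Finset.Ico 1 q, Real.cos (2 * π * l * a / q) * Real.cos (2 * π * l * b / q) * Real.cos (2 * π * l * c / q) =
      (((if (q : ℤ) ∣ a + b + c then (q : ℝ) else 0) + (if (q : ℤ) ∣ a + b - c then (q : ℝ) else 0) +
        (if (q : ℤ) ∣ a - b + c then (q : ℝ) else 0) + (if (q : ℤ) ∣ a - b - c then (q : ℝ) else 0)) - 4) / 4 := by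
  have e : ∀ l : ℕ, Real.cos (2 * π * l * a / q) * Real.cos (2 * π * l * b / q) * Real.cos (2 * π * l * c / q) =
      (Real.cos (2 * π * l * ((a + b + c : ℤ) : ℝ) / q) + Real.cos (2 * π * l * ((a + b - c : ℤ) : ℝ) / q) +
        Real.cos (2 * π * l * ((a - b + c : ℤ) : ℝ) / q) + Real.cos (2 * π * l * ((a - b - c : ℤ) : ℝ) / q)) / 4 := by
    intro l
    have h1 : 2 * π * l * ((a + b + c : ℤ) : ℝ) / q = 2 * π * l * a / q + 2 * π * l * b / q + 2 * π * l * c / q := by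
      push_cast; ring
    have h2 : 2 * π * l * ((a + b - c : ℤ) : ℝ) / q = (2 * π * l * a / q + 2 * π * l * b / q) - 2 * π * l * c / q := by
      push_cast; ring
    have h3 : 2 * π * l * ((a - b + c : ℤ) : ℝ) / q = (2 * π * l * a / q - 2 * π * l * b / q) + 2 * π * l * c / q := by
      push_cast; ring
    have h4 : 2 * π * l * ((a - b - c : ℤ) : ℝ) / q = (2 * π * l * a / q - 2 * π * l * b / q) - 2 * π * l * c / q := by
      push_cast; ring
    rw [h1, h2, h3, h4, Real.cos_add, Real.cos_sub, Real.cos_add (2 * π * l * a / q - 2 * π * l * b / q),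
      Real.cos_sub (2 * π * l * a / q - 2 * π * l * b / q), Real.cos_add, Real.cos_sub, Real.sin_add, Real.sin_sub]
    ring
  simp_rw [e]
  rw [← Finset.sum_div, Finset.sum_add_distrib, Finset.sum_add_distrib, Finset.sum_add_distrib, sum_Ico_cos_two_pi_mul_div_eq,
    sum_Ico_cos_two_pi_mul_div_eq, sum_Ico_cos_two_pi_mul_div_eq, sum_Ico_cos_two_pi_mul_div_eq]
  ring

/-- One term of `Ψ_{q,3}`: `∏_{j<3}(z² − a_jz + 1) = (z⁶+1) − e₁(z⁵+z) + (3 + e₂)(z⁴+z²) − (2e₁ + e₃)z³`, `aⱼ = 2cⱼ`, `eᵢ` the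
elementary symmetric functions of `(a₁, a₂, a₃)`. [cite: Ikeda1980, proof of Propositions 1.2 and 1.6] -/
private theorem prod_fin_three_quadratic (c : Fin 3 → ℝ) :
    ∏ i, (X ^ 2 - Polynomial.C (2 * c i) * X + 1 : ℝ[X]) =
      (X ^ 6 + 1) - Polynomial.C (2 * c 0 + 2 * c 1 + 2 * c 2) * (X ^ 5 + X) +
        Polynomial.C (3 + 4 * (c 0 * c 1 + c 0 * c 2 + c 1 * c 2)) * (X ^ 4 + X ^ 2) -
          Polynomial.C (2 * (2 * c 0 + 2 * c 1 + 2 * c 2) + 8 * (c 0 * c 1 * c 2)) * X ^ 3 := by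
  rw [Fin.prod_univ_three]
  have e1 : Polynomial.C (2 * c 0 + 2 * c 1 + 2 * c 2) =
      Polynomial.C (2 * c 0) + Polynomial.C (2 * c 1) + Polynomial.C (2 * c 2) := by rw [map_add, map_add]
  have e2 : Polynomial.C (3 + 4 * (c 0 * c 1 + c 0 * c 2 + c 1 * c 2)) = (3 : ℝ[X]) + (Polynomial.C (2 * c 0) * Polynomial.C (2 * c 1)
      + Polynomial.C (2 * c 0) * Polynomial.C (2 * c 2) + Polynomial.C (2 * c 1) * Polynomial.C (2 * c 2)) := by
    rw [← map_mul, ← map_mul, ← map_mul, ← map_add, ← map_add, ← map_ofNat Polynomial.C 3, ← map_add]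
    congr 1
    ring
  have e3 : Polynomial.C (2 * (2 * c 0 + 2 * c 1 + 2 * c 2) + 8 * (c 0 * c 1 * c 2)) =
      2 * (Polynomial.C (2 * c 0) + Polynomial.C (2 * c 1) + Polynomial.C (2 * c 2)) +
        Polynomial.C (2 * c 0) * Polynomial.C (2 * c 1) * Polynomial.C (2 * c 2) := by
    rw [← map_mul, ← map_mul, ← map_add, ← map_add, ← map_ofNat Polynomial.C 2, ← map_mul, ← map_add]
    congr 1
    ring
  rw [e1, e2, e3]
  ring

/-- **PROPOSITION 1.2 FOR `k = 3` WITH THE COEFFICIENT `a₃`: for `ω = (ω₁, ω₂, ω₃) ∈ Ĩ₀(q, 3)`,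
`Ψ_{q,3}(ω) = (q−1)(z⁶+1) + 6(z⁵+z) + (3q−15)(z⁴+z²) + (20 − 2q·|A_q(ω)|)z³`** where `|A_q(ω₁,ω₂,ω₃)| = #{(ξ,μ) ∈ {±1}² : ω₁ + ξω₂ +
μω₃ ≡ 0 (mod q)}` (written out as four indicators) — `a₀ = q−1`, `a₁ = −2k = −6`, `a₂ = k(q−2k+1) = 3q−15`, and `a₃ = 2q|A_q| − 20`
("In the same way as above", cf. the computation of `a₃` for `k = 4`). [cite: Ikeda1980, Proposition 1.2, Lemma 1.4 and Proposition 1.7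
(with the computation preceding Proposition 1.6)] -/
theorem IsIkedaWeights.ikedaPolynomial_fin_three {ω : Fin 3 → ℤ} (hω : IsIkedaWeights q ω) :
    ikedaPolynomial q ω =
      Polynomial.C ((q : ℝ) - 1) * (X ^ 6 + 1) + Polynomial.C 6 * (X ^ 5 + X) + Polynomial.C (3 * (q : ℝ) - 15) * (X ^ 4 + X ^ 2) +
        Polynomial.C (20 - 2 * (q : ℝ) *
          ((if (q : ℤ) ∣ ω 0 + ω 1 + ω 2 then 1 else 0) + (if (q : ℤ) ∣ ω 0 + ω 1 - ω 2 then 1 else 0) +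
            (if (q : ℤ) ∣ ω 0 - ω 1 + ω 2 then 1 else 0) + (if (q : ℤ) ∣ ω 0 - ω 1 - ω 2 then 1 else 0))) * X ^ 3 := by
  have hq1 : 1 ≤ q := hq.out.one_lt.le
  have hn : ∀ i, ¬(q : ℤ) ∣ ω i := hω.not_dvd
  have hs : ∀ i j, i ≠ j → ¬(q : ℤ) ∣ ω i - ω j := hω.not_dvd_sub
  have ha : ∀ i j, i ≠ j → ¬(q : ℤ) ∣ ω i + ω j := hω.not_dvd_add
  -- the three sums over `l`
  have hu : ∑ l ∈ Finset.Ico 1 q,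
      (2 * Real.cos (2 * π * l * ω 0 / q) + 2 * Real.cos (2 * π * l * ω 1 / q) + 2 * Real.cos (2 * π * l * ω 2 / q)) = -6 := by
    rw [Finset.sum_add_distrib, Finset.sum_add_distrib, ← Finset.mul_sum, ← Finset.mul_sum, ← Finset.mul_sum,
      sum_Ico_cos_two_pi_mul_div (hn 0), sum_Ico_cos_two_pi_mul_div (hn 1), sum_Ico_cos_two_pi_mul_div (hn 2)]
    norm_num
  have hw : ∑ l ∈ Finset.Ico 1 q, (3 + 4 * (Real.cos (2 * π * l * ω 0 / q) * Real.cos (2 * π * l * ω 1 / q) +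
      Real.cos (2 * π * l * ω 0 / q) * Real.cos (2 * π * l * ω 2 / q) + Real.cos (2 * π * l * ω 1 / q) * Real.cos (2 * π * l * ω 2 / q)))
      = 3 * (q : ℝ) - 15 := by
    rw [Finset.sum_add_distrib, Finset.sum_const, Nat.card_Ico, nsmul_eq_mul, Nat.cast_sub hq1, ← Finset.mul_sum,
      Finset.sum_add_distrib, Finset.sum_add_distrib, sum_Ico_cos_mul_cos (hs 0 1 (by decide)) (ha 0 1 (by decide)),
      sum_Ico_cos_mul_cos (hs 0 2 (by decide)) (ha 0 2 (by decide)), sum_Ico_cos_mul_cos (hs 1 2 (by decide)) (ha 1 2 (by decide))]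
    push_cast
    ring
  have hv : ∑ l ∈ Finset.Ico 1 q, (2 * (2 * Real.cos (2 * π * l * ω 0 / q) + 2 * Real.cos (2 * π * l * ω 1 / q) +
      2 * Real.cos (2 * π * l * ω 2 / q)) + 8 * (Real.cos (2 * π * l * ω 0 / q) * Real.cos (2 * π * l * ω 1 / q) *
        Real.cos (2 * π * l * ω 2 / q))) =
      -(20 - 2 * (q : ℝ) * ((if (q : ℤ) ∣ ω 0 + ω 1 + ω 2 then 1 else 0) + (if (q : ℤ) ∣ ω 0 + ω 1 - ω 2 then 1 else 0) +
            (if (q : ℤ) ∣ ω 0 - ω 1 + ω 2 then 1 else 0) + (if (q : ℤ) ∣ ω 0 - ω 1 - ω 2 then 1 else 0))) := by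
    rw [Finset.sum_add_distrib, ← Finset.mul_sum, ← Finset.mul_sum, hu, sum_Ico_cos_mul_cos_mul_cos]
    split_ifs <;> ring
  unfold ikedaPolynomial
  rw [Finset.sum_congr rfl fun (l : ℕ) _ ↦ prod_fin_three_quadratic (fun i ↦ Real.cos (2 * π * l * ω i / q)), Finset.sum_sub_distrib,
    Finset.sum_add_distrib, Finset.sum_sub_distrib, Finset.sum_const, Nat.card_Ico, ← Finset.sum_mul, ← Finset.sum_mul,
    ← Finset.sum_mul, ← map_sum, ← map_sum, ← map_sum, hu, hw, hv, nsmul_eq_mul, Nat.cast_sub hq1]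
  simp only [Nat.cast_one, map_sub, map_one, map_mul, map_neg, map_ofNat]
  rw [← Polynomial.C_eq_natCast]
  ring

/-- **PROPOSITION 1.7: for `ω, ω' ∈ Ĩ₀(q, 3)`, `Ψ_{q,3}(ω) = Ψ_{q,3}(ω')` as soon as `|A_q(ω)| = |A_q(ω')|`** (the printed "if and only
if"; this is the direction used for the examples). [cite: Ikeda1980, Proposition 1.7] -/
theorem IsIkedaWeights.ikedaPolynomial_fin_three_eq {ω ω' : Fin 3 → ℤ} (hω : IsIkedaWeights q ω) (hω' : IsIkedaWeights q ω')
    (hA : ((if (q : ℤ) ∣ ω 0 + ω 1 + ω 2 then 1 else 0) + (if (q : ℤ) ∣ ω 0 + ω 1 - ω 2 then 1 else 0) +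
            (if (q : ℤ) ∣ ω 0 - ω 1 + ω 2 then 1 else 0) + (if (q : ℤ) ∣ ω 0 - ω 1 - ω 2 then 1 else 0) : ℝ) =
          ((if (q : ℤ) ∣ ω' 0 + ω' 1 + ω' 2 then 1 else 0) + (if (q : ℤ) ∣ ω' 0 + ω' 1 - ω' 2 then 1 else 0) +
            (if (q : ℤ) ∣ ω' 0 - ω' 1 + ω' 2 then 1 else 0) + (if (q : ℤ) ∣ ω' 0 - ω' 1 - ω' 2 then 1 else 0) : ℝ)) :
    ikedaPolynomial q ω = ikedaPolynomial q ω' := by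
  rw [hω.ikedaPolynomial_fin_three, hω'.ikedaPolynomial_fin_three, hA]

end PropOneSeven

/-! ### §2 Example (I)(ii): the four 5-dimensional lens spaces `L(13 : 1, 2, 4)`, `L(13 : 1, 4, 8)`, `L(13 : 1, 2, 8)`, `L(13 : 1, 4, 3)` -/

section ExamplesDimFive

/-- `13` is prime. [folklore] -/
private theorem fact_prime_thirteen : Fact (Nat.Prime 13) := ⟨by norm_num⟩

/-- `(1, 2, 4, 3, 5, 6) ∈ Ĩ₀(13, 6)`: the weights `(1, 2, 4)` of `L(13 : 1, 2, 2²)` followed by complementary weights `(3, 5, 6)`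
(`{±1, ±2, ±4, ±3, ±5, ±6}` = all nonzero residues mod 13; Ikeda lists `ω = (2³, 2⁴, 2⁵) ≡ (8, 3, 6)`, equivalent up to sign).
[cite: Ikeda1980, §4 Example (I) Case (ii) (the table of `(q₁, q₂, q₃) = ω((r^{a₁}, r^{a₂}, r^{a₃}))`)] -/
theorem isIkedaWeights_thirteen_append_one_two_four : IsIkedaWeights 13 (Fin.append ![1, 2, 4] ![3, 5, 6]) := by
  have e : Fin.append ![(1 : ℤ), 2, 4] ![3, 5, 6] = ![1, 2, 4, 3, 5, 6] := by
    ext i; fin_cases i <;> rfl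
  rw [e]
  exact
    { isCoprime := fun i ↦ by fin_cases i <;> rw [Int.isCoprime_iff_gcd_eq_one] <;> rfl
      not_dvd_sub := fun i j hij ↦ by fin_cases i <;> fin_cases j <;> simp at hij ⊢
      not_dvd_add := fun i j hij ↦ by fin_cases i <;> fin_cases j <;> simp at hij ⊢ }

/-- `(1, 4, 8, 2, 3, 6) ∈ Ĩ₀(13, 6)`: `L(13 : 1, 2², 2³)` with complementary weights `(2, 3, 6)` (Ikeda: `(2, 2⁴, 2⁵) ≡ (2, 3, 6)`).
[cite: Ikeda1980, §4 Example (I) Case (ii)] -/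
theorem isIkedaWeights_thirteen_append_one_four_eight : IsIkedaWeights 13 (Fin.append ![1, 4, 8] ![2, 3, 6]) := by
  have e : Fin.append ![(1 : ℤ), 4, 8] ![2, 3, 6] = ![1, 4, 8, 2, 3, 6] := by
    ext i; fin_cases i <;> rfl
  rw [e]
  exact
    { isCoprime := fun i ↦ by fin_cases i <;> rw [Int.isCoprime_iff_gcd_eq_one] <;> rfl
      not_dvd_sub := fun i j hij ↦ by fin_cases i <;> fin_cases j <;> simp at hij ⊢
      not_dvd_add := fun i j hij ↦ by fin_cases i <;> fin_cases j <;> simp at hij ⊢ }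

/-- `(1, 2, 8, 3, 4, 6) ∈ Ĩ₀(13, 6)`: `L(13 : 1, 2, 2³)` with complementary weights `(3, 4, 6)` (Ikeda: `(2², 2⁴, 2⁵) ≡ (4, 3, 6)`).
[cite: Ikeda1980, §4 Example (I) Case (ii)] -/
theorem isIkedaWeights_thirteen_append_one_two_eight : IsIkedaWeights 13 (Fin.append ![1, 2, 8] ![3, 4, 6]) := by
  have e : Fin.append ![(1 : ℤ), 2, 8] ![3, 4, 6] = ![1, 2, 8, 3, 4, 6] := by
    ext i; fin_cases i <;> rfl
  rw [e]
  exact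
    { isCoprime := fun i ↦ by fin_cases i <;> rw [Int.isCoprime_iff_gcd_eq_one] <;> rfl
      not_dvd_sub := fun i j hij ↦ by fin_cases i <;> fin_cases j <;> simp at hij ⊢
      not_dvd_add := fun i j hij ↦ by fin_cases i <;> fin_cases j <;> simp at hij ⊢ }

/-- `(1, 4, 3, 2, 5, 6) ∈ Ĩ₀(13, 6)`: `L(13 : 1, 2², 2⁴)` with complementary weights `(2, 5, 6)` (Ikeda: `(2, 2³, 2⁵) ≡ (2, 8, 6)`).
[cite: Ikeda1980, §4 Example (I) Case (ii)] -/
theorem isIkedaWeights_thirteen_append_one_four_three : IsIkedaWeights 13 (Fin.append ![1, 4, 3] ![2, 5, 6]) := by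
  have e : Fin.append ![(1 : ℤ), 4, 3] ![2, 5, 6] = ![1, 4, 3, 2, 5, 6] := by
    ext i; fin_cases i <;> rfl
  rw [e]
  exact
    { isCoprime := fun i ↦ by fin_cases i <;> rw [Int.isCoprime_iff_gcd_eq_one] <;> rfl
      not_dvd_sub := fun i j hij ↦ by fin_cases i <;> fin_cases j <;> simp at hij ⊢
      not_dvd_add := fun i j hij ↦ by fin_cases i <;> fin_cases j <;> simp at hij ⊢ }

/-- **IKEDA'S 5-DIMENSIONAL EXAMPLE (I)(ii), FIRST PAIR: `L(13 : 1, 2, 4)` and `L(13 : 1, 4, 8)` ARE ISOSPECTRAL** — both have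
`|A_q(ω)| = 0` in Ikeda's table, so Proposition 1.7 and Proposition 2.6 apply ("By Proposition 1.7 and 2.6, the lens spaces `L(13: 1,
2, 2²)` and `L(13: 1, 2², 2³)` are isospectral to each other"). [cite: Ikeda1980, §4 Example (I) Case (ii)] -/
theorem lensSpaceMultiplicity_thirteen_one_two_four_eq (m : ℕ) :
    lensSpaceMultiplicity 13 ![1, 2, 4] m = lensSpaceMultiplicity 13 ![1, 4, 8] m := by
  haveI := fact_prime_thirteen
  refine (lensSpaceMultiplicity_eq_iff_ikedaPolynomial_eq (n := 2) (k := 3) (by norm_num)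
    isIkedaWeights_thirteen_append_one_two_four isIkedaWeights_thirteen_append_one_four_eight (by norm_num)).mpr ?_ m
  refine isIkedaWeights_thirteen_append_one_two_four.append_right.ikedaPolynomial_fin_three_eq
    isIkedaWeights_thirteen_append_one_four_eight.append_right ?_
  simp only [Matrix.cons_val_zero, Matrix.cons_val_one, Matrix.cons_val]
  norm_num

/-- **… SECOND PAIR: `L(13 : 1, 2, 8)` and `L(13 : 1, 4, 3)` ARE ISOSPECTRAL** (both have `|A_q(ω)| = 1`: `3 + 4 + 6 ≡ 0 ≡ 2 + 5 + 6`)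
("and also the lens spaces `L(13: 1, 2, 2³)`, `L(13: 1, 2², 2⁴)` are isospectral"). [cite: Ikeda1980, §4 Example (I) Case (ii)] -/
theorem lensSpaceMultiplicity_thirteen_one_two_eight_eq (m : ℕ) :
    lensSpaceMultiplicity 13 ![1, 2, 8] m = lensSpaceMultiplicity 13 ![1, 4, 3] m := by
  haveI := fact_prime_thirteen
  refine (lensSpaceMultiplicity_eq_iff_ikedaPolynomial_eq (n := 2) (k := 3) (by norm_num)
    isIkedaWeights_thirteen_append_one_two_eight isIkedaWeights_thirteen_append_one_four_three (by norm_num)).mpr ?_ m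
  refine isIkedaWeights_thirteen_append_one_two_eight.append_right.ikedaPolynomial_fin_three_eq
    isIkedaWeights_thirteen_append_one_four_three.append_right ?_
  simp only [Matrix.cons_val_zero, Matrix.cons_val_one, Matrix.cons_val]
  norm_num

/-- … while the two pairs are NOT isospectral to each other (`|A_q| = 0` versus `1`): already `dim E_{3·7}` differs, `4 ≠ 2`.
[cite: Ikeda1980, §4 Example (I) Case (ii) and Proposition 1.7] -/
theorem lensSpaceMultiplicity_thirteen_one_two_four_ne : lensSpaceMultiplicity 13 ![1, 2, 4] 3 ≠ lensSpaceMultiplicity 13 ![1, 2, 8] 3 := by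
  decide

/-- The homotopy criterion of Theorem 2.2 with `l` reduced mod `13`, `n = 3`. [folklore] -/
private theorem prod_modEq_reduce_three {P S e l : ℤ} (h : S ≡ e * l ^ 3 * P [ZMOD 13]) :
    S % 13 = (e * (l % 13) ^ 3 * P) % 13 :=
  h.trans ((((Int.mod_modEq l 13).symm.pow 3).mul_left e).mul_right P)

/-- **ISOSPECTRAL 5-MANIFOLDS WHICH ARE NOT HOMOTOPY EQUIVALENT: `L(13 : 1, 2, 4) ≄ L(13 : 1, 4, 8)`** — `1·4·8 = 32 ≢ ±l³·8 (mod 13)`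
for every `l` (the cubes mod 13 are `0, ±1, ±5`), so Theorem 2.2 excludes a homotopy equivalence ("these isospectral lens spaces are
non-homotopy equivalent to each other. This fact follows easily from the facts `rⁿ = 2³ ≡ 8 (mod 13)` and `(2³)² ≡ −1 (mod 13)`, and
Theorem 2.2"). [cite: Ikeda1980, §4 Example (I) Case (ii) and Theorem 2.2] -/
theorem not_lensWeightsHomotopyEquivalent_thirteen_one_two_four :
    ¬LensWeightsHomotopyEquivalent 13 ![1, 2, 4] ![1, 4, 8] := by
  rintro ⟨l, e, he, h⟩
  have key := prod_modEq_reduce_three h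
  have h0 : 0 ≤ l % 13 := Int.emod_nonneg _ (by norm_num)
  have h1 : l % 13 < 13 := Int.emod_lt_of_pos _ (by norm_num)
  generalize l % 13 = r at key h0 h1
  rcases he with rfl | rfl <;> interval_cases r <;> revert key <;> decide

/-- **… and `L(13 : 1, 2, 8) ≄ L(13 : 1, 4, 3)`** (`1·4·3 = 12 ≢ ±l³·16 (mod 13)` for every `l`). [cite: Ikeda1980, §4 Example (I)
Case (ii) and Theorem 2.2] -/
theorem not_lensWeightsHomotopyEquivalent_thirteen_one_two_eight :
    ¬LensWeightsHomotopyEquivalent 13 ![1, 2, 8] ![1, 4, 3] := by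
  rintro ⟨l, e, he, h⟩
  have key := prod_modEq_reduce_three h
  have h0 : 0 ≤ l % 13 := Int.emod_nonneg _ (by norm_num)
  have h1 : l % 13 < 13 := Int.emod_lt_of_pos _ (by norm_num)
  generalize l % 13 = r at key h0 h1
  rcases he with rfl | rfl <;> interval_cases r <;> revert key <;> decide

end ExamplesDimFive

end Literature.Analysis.InnerProduct
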